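import Literature.MathematicalPhysics.QuantumFieldTheory.Jegerlehner2017.SpectralFunctionInsertions
import Literature.Analysis.TotalPositivity.PolyaFrequencyZeros
import Mathlib.Analysis.SpecialFunctions.Log.Deriv
import HarnessLib

/-!
# The one-loop kernel `K` as a power series on the unit disc, and its majorant `𝒦`
(venture QEDPrecision, cell `pub-qed`, literature seat, gen 13; folder `SpectralMajorants/`, file 1)

HONEST FRAMING (verbatim, venture QEDPrecision): independent recomputation; certified where stated,
statistical where stated; no new-physics claim.

## What this file is

The I(b)/I(c) certificate of the cell (HOME `certs/SetIbIc/`, instrument B1′) bounds the Gauss–Legendre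
remainder of its outer `x`-quadrature with the KERNEL theorem
`Literature.Analysis.Quadrature.norm_integral_sub_gaussLegendre_le_interval`, whose premise — the
integrand is complex-analytic on a Bernstein region and bounded there by an explicit `M` — was derived ON
PAPER in `certs/SetIbIc/repr/gl_bounds.md` §2.  This folder makes that premise a kernel statement about the
Lean-typed objects of `Literature/…/Jegerlehner2017/SpectralFunctionInsertions.lean` (p217042).  This file is
§2.2 of the note, for the inner one-loop integral

  `K(x) := ∫₀¹ ρ₂(t)/W_t(x) dt = 4/(3x²) − 4/(3x) − 5/9 + (x³−6x+4)/(3x³)·ln(1−x)`   (`0 < x < 1`),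

whose power series `K(x) = Σ_{n≥1} n(n+7)/(3(n+1)(n+3)(n+4)) xⁿ⁺¹` is the tree's
`Jegerlehner2017.neg_piOneLoop_sX_hasSum` (with `integral_rho2_div_wt_eq_neg_piOneLoop`):

* `kCoeff n = n(n+7)/(3(n+1)(n+3)(n+4))`, `0 ≤ kCoeff n ≤ 1/(3(n+1))` and `kCoeff 0 = 0`;
* `kC z := z · Σₙ kCoeff n zⁿ` — the complex extension of `K` to the open unit disc as a power series;
  `kC_ofReal` : for `0 < x < 1`, `kC x = ∫₀¹ ρ₂(t)/W_t(x) dt` (the typed real object);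
* `differentiableOn_kC` : `kC` is complex-differentiable on `ball 0 1` (power series with bounded
  coefficients; via `Literature.Analysis.TotalPositivity.hasFPowerSeriesOnBall_of_hasSum`);
* `norm_kC_le` : `‖kC z‖ ≤ 𝒦(‖z‖)` for `‖z‖ < 1`, `𝒦(r) := kMaj r = (1/3)(−ln(1−r) − r)` — EXACTLY the
  majorant of gl_bounds.md §2.2 ("`a_k ≥ 0` and `a_k ≤ 1/(3k)`, so `|K(z)| ≤ Σ a_k r^k ≤ (1/3)Σ_{k≥2} r^k/k`");
* `kMaj_nonneg`, `kMaj_mono` (so `‖z‖ ≤ r < 1 ⇒ ‖kC z‖ ≤ 𝒦(r)`, `norm_kC_le_of_norm_le`), and the real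
  corollary `abs_integral_rho2_div_wt_le_kMaj` : `0 < x < 1 ⇒ |K(x)| ≤ 𝒦(x)`.

NEW WORK of the cell (elementary analysis about the cell's typed objects), not a published result; nothing
here is cited as a fact anywhere; no numerical value of any anomaly integral is asserted.  Not an R-row.
-/

noncomputable section

open Real Set MeasureTheory intervalIntegral

namespace Summit.Ventures.QEDPrecision.SpectralMajorants

open Literature.MathematicalPhysics.QuantumFieldTheory.Jegerlehner2017

/-! ### The coefficients -/

/-- The power-series coefficient of `xⁿ⁺¹` in `K(x)`: `n(n+7)/(3(n+1)(n+3)(n+4))`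
(= `a_{n+1}` of gl_bounds.md §1 with `a_k = (k−1)(k+6)/(3k(k+2)(k+3))`). -/
def kCoeff (n : ℕ) : ℝ :=
  (n : ℝ) * ((n : ℝ) + 7) / (3 * (((n : ℝ) + 1) * ((n : ℝ) + 3) * ((n : ℝ) + 4)))

/-- `a_1 = 0`: the series of `K` starts at `x²`. -/
theorem kCoeff_zero : kCoeff 0 = 0 := by simp [kCoeff]

/-- `a_k ≥ 0`. -/
theorem kCoeff_nonneg (n : ℕ) : 0 ≤ kCoeff n := by
  unfold kCoeff; positivity

/-- `a_k ≤ 1/(3k)`: here `kCoeff n ≤ 1/(3(n+1))`, because `n(n+7) ≤ (n+3)(n+4)`. -/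
theorem kCoeff_le (n : ℕ) : kCoeff n ≤ 1 / (3 * ((n : ℝ) + 1)) := by
  unfold kCoeff
  have h1 : (0 : ℝ) < (n : ℝ) + 1 := by positivity
  have h3 : (0 : ℝ) < ((n : ℝ) + 3) * ((n : ℝ) + 4) := by positivity
  rw [div_le_div_iff₀ (by positivity) (by positivity)]
  nlinarith [h1, h3, mul_pos h1 h3]

/-- The cruder uniform bound `kCoeff n ≤ 1/3`. -/
theorem kCoeff_le_third (n : ℕ) : kCoeff n ≤ 1 / 3 := by
  refine (kCoeff_le n).trans ?_
  have h1 : (1 : ℝ) ≤ (n : ℝ) + 1 := by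
    have : (0 : ℝ) ≤ n := Nat.cast_nonneg n
    linarith
  rw [div_le_div_iff₀ (by positivity) (by norm_num)]
  nlinarith

/-! ### The complex power series -/

/-- `Σₙ kCoeff n · zⁿ` (so that `K = z · kS z`). -/
def kS (z : ℂ) : ℂ := ∑' n : ℕ, (kCoeff n : ℂ) * z ^ n

/-- The complex extension of the one-loop kernel `K` to the unit disc: `kC z = z · Σₙ kCoeff n zⁿ`. -/
def kC (z : ℂ) : ℂ := z * kS z

/-- Termwise geometric domination `‖aₙ zⁿ‖ ≤ ‖z‖ⁿ/3`. -/
theorem norm_kCoeff_mul_pow_le (n : ℕ) (z : ℂ) :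
    ‖(kCoeff n : ℂ) * z ^ n‖ ≤ 1 / 3 * ‖z‖ ^ n := by
  rw [norm_mul, norm_pow, Complex.norm_real, Real.norm_eq_abs, abs_of_nonneg (kCoeff_nonneg n)]
  exact mul_le_mul_of_nonneg_right (kCoeff_le_third n) (pow_nonneg (norm_nonneg _) _)

/-- Absolute convergence of the series of `kS` on the open unit disc. -/
theorem summable_norm_kS_term {z : ℂ} (hz : ‖z‖ < 1) :
    Summable fun n : ℕ => ‖(kCoeff n : ℂ) * z ^ n‖ := by
  refine Summable.of_nonneg_of_le (fun n => norm_nonneg _) (fun n => norm_kCoeff_mul_pow_le n z) ?_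
  exact (summable_geometric_of_lt_one (norm_nonneg _) hz).mul_left (1 / 3)

/-- `kS z = Σₙ kCoeff n zⁿ` as a `HasSum`, `‖z‖ < 1`. -/
theorem kS_hasSum {z : ℂ} (hz : ‖z‖ < 1) :
    HasSum (fun n : ℕ => (kCoeff n : ℂ) * z ^ n) (kS z) :=
  (summable_norm_kS_term hz).of_norm.hasSum

/-- `kS` is given by its power series on the unit ball, hence analytic there. -/
theorem hasFPowerSeriesOnBall_kS :
    HasFPowerSeriesOnBall kS (FormalMultilinearSeries.ofScalars ℂ (fun n => (kCoeff n : ℂ))) 0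
      (ENNReal.ofReal 1) :=
  Literature.Analysis.TotalPositivity.hasFPowerSeriesOnBall_of_hasSum one_pos
    (fun _ hz => kS_hasSum hz)

/-- `kS` is complex-differentiable on the open unit disc. -/
theorem differentiableOn_kS : DifferentiableOn ℂ kS (Metric.ball (0 : ℂ) 1) := by
  have h := hasFPowerSeriesOnBall_kS.differentiableOn
  rwa [Metric.eball_ofReal] at h

/-- **`K` is complex-differentiable on the open unit disc** (gl_bounds.md §2.1: "K is analytic … on the unit
disc by its power series"). -/
theorem differentiableOn_kC : DifferentiableOn ℂ kC (Metric.ball (0 : ℂ) 1) :=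
  differentiableOn_id.mul differentiableOn_kS

/-! ### Agreement with the typed real object on `(0,1)` -/

/-- For `0 ≤ x < 1` the real series: `Σ kCoeff n xⁿ⁺¹ = −Π₂(s_x)` (the tree's `neg_piOneLoop_sX_hasSum`). -/
theorem hasSum_kCoeff_real {x : ℝ} (hx0 : 0 ≤ x) (hx1 : x < 1) :
    HasSum (fun n : ℕ => kCoeff n * x ^ (n + 1)) (-piOneLoop (sX x)) := by
  refine (neg_piOneLoop_sX_hasSum hx0 hx1).congr_fun fun n => ?_
  simp only [kCoeff]

/-- **`kC` extends `K`**: for `0 < x < 1`, `kC x = ∫₀¹ ρ₂(t)/W_t(x) dt`. -/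
theorem kC_ofReal {x : ℝ} (hx0 : 0 < x) (hx1 : x < 1) :
    kC (x : ℂ) = ((∫ t in (0:ℝ)..1, rho2 t / wt t x 1 : ℝ) : ℂ) := by
  rw [integral_rho2_div_wt_eq_neg_piOneLoop hx0 hx1]
  have hxn : ‖(x : ℂ)‖ < 1 := by
    rw [Complex.norm_real, Real.norm_eq_abs, abs_of_pos hx0]; exact hx1
  have h1 : HasSum (fun n : ℕ => (x : ℂ) * ((kCoeff n : ℂ) * (x : ℂ) ^ n)) (kC (x : ℂ)) :=
    (kS_hasSum hxn).mul_left (x : ℂ)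
  have h2 : HasSum (fun n : ℕ => ((kCoeff n * x ^ (n + 1) : ℝ) : ℂ)) ((-piOneLoop (sX x) : ℝ) : ℂ) :=
    (Complex.ofRealCLM.hasSum (hasSum_kCoeff_real hx0.le hx1))
  have h3 : (fun n : ℕ => ((kCoeff n * x ^ (n + 1) : ℝ) : ℂ))
      = fun n : ℕ => (x : ℂ) * ((kCoeff n : ℂ) * (x : ℂ) ^ n) := by
    funext n; push_cast; ring
  rw [h3] at h2
  exact h1.unique h2

/-! ### The majorant `𝒦(r) = (1/3)(−ln(1−r) − r)` -/

/-- gl_bounds.md §2.2's `𝒦(r) := (1/3)(ln(1/(1−r)) − r)`. -/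
def kMaj (r : ℝ) : ℝ := 1 / 3 * (-Real.log (1 - r) - r)

/-- `𝒦(0) = 0`. -/
theorem kMaj_zero : kMaj 0 = 0 := by simp [kMaj]

/-- `𝒦` is non-decreasing on `[0,1)`. -/
theorem kMaj_mono {r₁ r₂ : ℝ} (h0 : 0 ≤ r₁) (h12 : r₁ ≤ r₂) (h2 : r₂ < 1) : kMaj r₁ ≤ kMaj r₂ := by
  unfold kMaj
  have hp1 : 0 < 1 - r₁ := by linarith
  have hp2 : 0 < 1 - r₂ := by linarith
  -- log((1−r₁)/(1−r₂)) ≥ 1 − (1−r₂)/(1−r₁) = (r₂ − r₁)/(1 − r₁) ≥ r₂ − r₁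
  have hlog : Real.log (1 - r₁) - Real.log (1 - r₂) ≥ r₂ - r₁ := by
    rw [← Real.log_div hp1.ne' hp2.ne']
    have h := Real.one_sub_inv_le_log_of_pos (div_pos hp1 hp2)
    rw [inv_div] at h
    have h' : 1 - (1 - r₂) / (1 - r₁) = (r₂ - r₁) / (1 - r₁) := by field_simp; ring
    rw [h'] at h
    have h'' : r₂ - r₁ ≤ (r₂ - r₁) / (1 - r₁) := by
      rw [le_div_iff₀ hp1]; nlinarith
    linarith
  nlinarith

/-- `𝒦 ≥ 0` on `[0,1)`. -/
theorem kMaj_nonneg {r : ℝ} (h0 : 0 ≤ r) (h1 : r < 1) : 0 ≤ kMaj r := by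
  have := kMaj_mono le_rfl h0 h1
  rwa [kMaj_zero] at this

/-- The majorant series: `Σₙ Mₙ = 𝒦(ρ)` with `Mₙ = ρⁿ⁺¹/(3(n+1))` for `n ≥ 1` and `M₀ = 0`. -/
theorem hasSum_kMaj {ρ : ℝ} (h0 : 0 ≤ ρ) (h1 : ρ < 1) :
    HasSum (fun n : ℕ => ρ ^ (n + 1) / (3 * ((n : ℝ) + 1)) - if n = 0 then ρ / 3 else 0) (kMaj ρ) := by
  have habs : |ρ| < 1 := by rw [abs_of_nonneg h0]; exact h1
  have hL := (Real.hasSum_pow_div_log_of_abs_lt_one habs).div_const 3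
  have hI := hasSum_ite_eq 0 (ρ / 3)
  have h := hL.sub hI
  have hv : -Real.log (1 - ρ) / 3 - ρ / 3 = kMaj ρ := by unfold kMaj; ring
  rw [hv] at h
  refine h.congr_fun fun n => ?_
  have e : ρ ^ (n + 1) / (3 * ((n : ℝ) + 1)) = ρ ^ (n + 1) / ((n : ℝ) + 1) / 3 := by
    rw [div_div, mul_comm]
  rw [e]

/-- Termwise: `aₙ ρⁿ⁺¹ ≤ Mₙ` (the majorant series of `hasSum_kMaj`). -/
theorem kCoeff_mul_pow_le {ρ : ℝ} (h0 : 0 ≤ ρ) (n : ℕ) :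
    kCoeff n * ρ ^ (n + 1) ≤ ρ ^ (n + 1) / (3 * ((n : ℝ) + 1)) - if n = 0 then ρ / 3 else 0 := by
  by_cases hn : n = 0
  · subst hn; simp [kCoeff]
  · simp only [hn, if_false, sub_zero]
    have h := mul_le_mul_of_nonneg_right (kCoeff_le n) (pow_nonneg h0 (n + 1))
    calc kCoeff n * ρ ^ (n + 1) ≤ 1 / (3 * ((n : ℝ) + 1)) * ρ ^ (n + 1) := h
      _ = ρ ^ (n + 1) / (3 * ((n : ℝ) + 1)) := by ring

/-- **The majorant of gl_bounds.md §2.2**: `‖K(z)‖ ≤ 𝒦(‖z‖)` on the open unit disc. -/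
theorem norm_kC_le {z : ℂ} (hz : ‖z‖ < 1) : ‖kC z‖ ≤ kMaj ‖z‖ := by
  have h0 : 0 ≤ ‖z‖ := norm_nonneg z
  -- ‖kC z‖ = ‖Σ kCoeff n z^(n+1)‖ ≤ Σ kCoeff n ‖z‖^(n+1) ≤ Σ Mₙ = 𝒦(‖z‖)
  have hser : HasSum (fun n : ℕ => (kCoeff n : ℂ) * z ^ (n + 1)) (kC z) := by
    refine ((kS_hasSum hz).mul_left z).congr_fun fun n => ?_
    ring
  have hnorm : ∀ n : ℕ, ‖(kCoeff n : ℂ) * z ^ (n + 1)‖ = kCoeff n * ‖z‖ ^ (n + 1) := by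
    intro n
    rw [norm_mul, norm_pow, Complex.norm_real, Real.norm_eq_abs, abs_of_nonneg (kCoeff_nonneg n)]
  have hsM := hasSum_kMaj h0 hz
  have hsN : Summable fun n : ℕ => ‖(kCoeff n : ℂ) * z ^ (n + 1)‖ := by
    refine Summable.of_nonneg_of_le (fun n => norm_nonneg _) (fun n => ?_) hsM.summable
    rw [hnorm]; exact kCoeff_mul_pow_le h0 n
  calc ‖kC z‖ = ‖∑' n : ℕ, (kCoeff n : ℂ) * z ^ (n + 1)‖ := by rw [hser.tsum_eq]
    _ ≤ ∑' n : ℕ, ‖(kCoeff n : ℂ) * z ^ (n + 1)‖ := norm_tsum_le_tsum_norm hsN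
    _ ≤ ∑' n : ℕ, (‖z‖ ^ (n + 1) / (3 * ((n : ℝ) + 1)) - if n = 0 then ‖z‖ / 3 else 0) :=
        hsN.tsum_le_tsum (fun n => by rw [hnorm]; exact kCoeff_mul_pow_le h0 n) hsM.summable
    _ = kMaj ‖z‖ := hsM.tsum_eq

/-- `‖z‖ ≤ r < 1 ⇒ ‖K(z)‖ ≤ 𝒦(r)` (the form used on a disc containing a Bernstein region). -/
theorem norm_kC_le_of_norm_le {z : ℂ} {r : ℝ} (hzr : ‖z‖ ≤ r) (hr : r < 1) : ‖kC z‖ ≤ kMaj r :=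
  (norm_kC_le (lt_of_le_of_lt hzr hr)).trans (kMaj_mono (norm_nonneg z) hzr hr)

/-- Real corollary: for `0 < x < 1`, `|K(x)| ≤ 𝒦(x)` (and `K(x) ≥ 0` is the tree's
`neg_piOneLoop_sX_bounds`). -/
theorem abs_integral_rho2_div_wt_le_kMaj {x : ℝ} (hx0 : 0 < x) (hx1 : x < 1) :
    |∫ t in (0:ℝ)..1, rho2 t / wt t x 1| ≤ kMaj x := by
  have hxn : ‖(x : ℂ)‖ = x := by rw [Complex.norm_real, Real.norm_eq_abs, abs_of_pos hx0]
  have h := norm_kC_le (z := (x : ℂ)) (by rw [hxn]; exact hx1)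
  rwa [kC_ofReal hx0 hx1, Complex.norm_real, Real.norm_eq_abs, hxn] at h

end Summit.Ventures.QEDPrecision.SpectralMajorants

end
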